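import Summits.AnomalousDissipation.AnomalousDissipation.Cruxes.NoScreening.KleinPoleSketch

/-!
# Ideator sketch (k = 2, round 1) — crux `NoScreening` (stmt-AnomalousDissipation-17144)
# idea `symmetric-sector-persistence`: the quiet polar branch lives in the fixed space of
# S₃ × ⟨PT⟩, where the linearised Euler operator at u* has NO resonance at 0 (the exact kernel
# vector U′ = b₀ − b₀′ is sign ⊗ PT-odd), and its first corrector is an L² field whose only
# singularities are `1/|x − x_s|` at the eight hyperbolic stagnation points of u*; what remains at 0 in the sector
# is ONE real near-resonant mode e (|λ_L| ≲ 0.1) whose Lyapunov–Schmidt numbers decide persistence below ν× ≈ 4·10⁻⁴.  Rungs of the line, typed over the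
# KleinPole vocabulary (`stirB`, `b1'`, `sphereForce`, `polarC`, `IsAdmissibleSteadyState`,
# `QuietPolarSteadyStates`, `PolarKleinOrbit`, `not_noScreening_of_polar`):
#  * `FirstCorrectorL2`      — rung 1 (ν = 0): the outer first-order corrector exists in L² (weak form).
#  * `ViscousCorrector`      — rung 2 (linear, ν > 0): the viscous corrector w_ν = (νA + L_{u*})⁻¹(A u*)
#                              exists in the sector with ‖w_ν‖ ≤ C, ‖∇w_ν‖² ≤ C² ν^{-1/2}.
#  * `NearResonantMode`      — the organising object: a real near-zero mode of L_{u*} on the sector (|λ| ≤ 1/10).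
#  * `SymmetricQuietSequence` — target of the line (nonlinear closure): symmetric quiet steady states
#                              along ν_j → 0 with |(u,b₂)| ≤ C ν.
#  * `quietPolar_of_symmetric`, `not_noScreening_of_symmetricQuiet` — composition with KleinPole (PROVED here).
-/

set_option linter.dupNamespace false

noncomputable section

open MeasureTheory
open scoped BigOperators Real InnerProductSpace

namespace Summit.AnomalousDissipation.AnomalousDissipation.Cruxes.NoScreening.SymmetricSector

open Summit.AnomalousDissipation.AnomalousDissipation.Cruxes.NoScreening.KleinPole

local notation "𝕋³" => UnitAddTorus (Fin 3)
local notation "E³" => EuclideanSpace ℝ (Fin 3)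
local notation "L2T" => Lp (EuclideanSpace ℝ (Fin 3)) 2 (volume : Measure (UnitAddTorus (Fin 3)))
local notation "H" => Literature.Analysis.FunctionSpaces.Torus.energySpace (Fin 3)

/-- The explicit Euler-balanced polar state `u* = (2π)^{-1/2}(b₁ + b₁′)` as a function
(`u*(x) = ρ (C₂+C₃, C₃+C₁, C₁+C₂)`, `Cᵢ = cos 2πxᵢ`, `2πρ² = 1`). -/
def uStar : 𝕋³ → E³ := fun x => (Real.sqrt (2 * π))⁻¹ • (stirB 1 x + b1' x)

/-- The half-diagonal point `(½,½,½)` of `T³`. -/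
def half : 𝕋³ := fun _ => ((2⁻¹ : ℝ) : UnitAddCircle)

/-- Axis symmetry (the trivial representation of `S₃`): `u(x ∘ σ) = (u x) ∘ σ` for every
permutation `σ` of the three coordinates (vector components permuted with the coordinates). -/
def IsAxisSymmetric (u : 𝕋³ → E³) : Prop :=
  ∀ (σ : Equiv.Perm (Fin 3)) (x : 𝕋³), u (x ∘ σ) = WithLp.toLp 2 (fun i => u x (σ i))

/-- `PT`-symmetry: invariance under `u ↦ −u(−· + (½,½,½))` (parity composed with the half-diagonal
shift; both flip `u*`, their product fixes it). -/
def IsPTSymmetric (u : 𝕋³ → E³) : Prop :=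
  ∀ x : 𝕋³, u (-x + half) = -u x

/-- The polarised inertial pairing `∫ ⟪(u·∇)φ, v⟫ + ⟪(v·∇)φ, u⟫ = −⟨B(u,v) + B(v,u), φ⟩`
(all derivatives on the smooth test field `φ`, as in `inertialPairing`). -/
def polarInertial (u v φ : 𝕋³ → E³) : ℝ :=
  ∫ x, (⟪Literature.Analysis.FunctionSpaces.Torus.fderiv φ x (u x), v x⟫_ℝ +
        ⟪Literature.Analysis.FunctionSpaces.Torus.fderiv φ x (v x), u x⟫_ℝ)

/-- A smooth solenoidal mean-zero test field. -/
def IsTest (φ : 𝕋³ → E³) : Prop :=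
  Literature.Analysis.FunctionSpaces.Torus.IsSmooth φ ∧ Literature.Analysis.FunctionSpaces.Torus.IsDivFree φ ∧
    Literature.Analysis.FunctionSpaces.Torus.HasZeroMean φ

/-- **Rung 1 (ν = 0, outer problem).** The first-order corrector of the pinned polar problem exists
in `L²` inside the symmetric sector: some square-integrable, axis- and PT-symmetric `w` and a force
multiplier `s` solve `L_{u*} w + s b₂ = −A u*` weakly, i.e.
`−polarInertial u* w φ + s (b₂, φ) = (u*, Δφ)` for every test field `φ`.
(Numerics, kit j026367/j026451: Galerkin least squares; if the full-image residual does not tend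
to `0` the rung is false in `L²` and the line must move to rougher (anisotropic) spaces.) -/
def FirstCorrectorL2 : Prop :=
  ∃ (w : 𝕋³ → E³) (s : ℝ), MemLp w 2 volume ∧ IsAxisSymmetric w ∧ IsPTSymmetric w ∧
    ∀ φ : 𝕋³ → E³, IsTest φ →
      -polarInertial uStar w φ + s * (∫ x, ⟪stirB 2 x, φ x⟫_ℝ) = ∫ x, ⟪uStar x, Literature.Analysis.FunctionSpaces.Torus.laplacian φ x⟫_ℝ

/-- **Rung 2 (linear, ν > 0).** The viscous first corrector `w_ν := (νA + L_{u*})⁻¹ (A u*)` exists in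
the symmetric sector with the stagnation-point scalings `‖w_ν‖_{L²} ≤ C`, `‖∇w_ν‖² ≤ C² ν^{-1/2}`
(weak form: `−ν (w, Δφ) − polarInertial u* w φ = (u*, Δφ)`·(−1), i.e. `νA w + L w = A u*`). -/
def ViscousCorrector : Prop :=
  ∃ C ν₀ : ℝ, 0 < C ∧ 0 < ν₀ ∧ ∀ ν : ℝ, 0 < ν → ν < ν₀ →
    ∃ w : H, ((w : L2T) ∈ Literature.Analysis.FunctionSpaces.Torus.energySpaceV (Fin 3)) ∧
      (∃ v : 𝕋³ → E³, Continuous v ∧ IsAxisSymmetric v ∧ IsPTSymmetric v ∧ (((w : L2T) : 𝕋³ → E³) =ᵐ[volume] v)) ∧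
      (∀ φ : 𝕋³ → E³, IsTest φ →
        -ν * (∫ x, ⟪((w : L2T) : 𝕋³ → E³) x, Literature.Analysis.FunctionSpaces.Torus.laplacian φ x⟫_ℝ)
          - polarInertial uStar ((w : L2T) : 𝕋³ → E³) φ
          = -∫ x, ⟪uStar x, Literature.Analysis.FunctionSpaces.Torus.laplacian φ x⟫_ℝ) ∧
      ‖w‖ ≤ C ∧
      (Literature.Analysis.FunctionSpaces.Torus.eGradNormSq ((w : L2T) : 𝕋³ → E³)).toReal ≤ C ^ 2 * ν ^ (-(1 / 2 : ℝ))

/-- **The near-resonant mode (the organising object; numerics kit j026451/j026558/j026571).** The linearised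
Euler operator at `u*` restricted to the symmetric sector has a REAL near-zero mode: a square-integrable, axis- and
PT-symmetric `e ≠ 0` and `|λ| ≤ 1/10` with `L_{u*} e = λ e` weakly (`−polarInertial u* e φ = λ (e, φ)` for all test
fields).  Its sign and the Lyapunov–Schmidt coefficients `a = ⟨e*, A u*⟩`, `b = ⟨e*, A e⟩`, `c = ⟨e*, B(e,e)⟩` decide whether
`u*` persists below `ν× = |λ|/b ≈ 4·10⁻⁴` (the computed quiet branch veers away from `u*` at `ν×`). -/
def NearResonantMode : Prop :=
  ∃ (e : 𝕋³ → E³) (lam : ℝ), MemLp e 2 volume ∧ IsAxisSymmetric e ∧ IsPTSymmetric e ∧ (∫ x, ‖e x‖ ^ 2) = 1 ∧ |lam| ≤ 1 / 10 ∧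
    ∀ φ : 𝕋³ → E³, IsTest φ → -polarInertial uStar e φ = lam * ∫ x, ⟪e x, φ x⟫_ℝ

/-- **Target of the line (nonlinear closure).** Along a sequence `ν → 0` the pole force `f_{−e₂} = −b₂` has admissible
steady states that are axis- and PT-symmetric, with bounded energy and polar response `|(u, b₂)| (= ν‖∇u‖²) ≤ C ν`.
(No rate of approach to `u*` is asserted: by the near-resonance the rate may be `ν`, `√ν`, or the limit may be a
neighbouring balanced state.) -/
def SymmetricQuietSequence : Prop :=
  ∃ E C : ℝ, 0 < E ∧ 0 < C ∧ ∀ ν₀ : ℝ, 0 < ν₀ → ∃ (ν : ℝ) (u : H), 0 < ν ∧ ν < ν₀ ∧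
    IsAdmissibleSteadyState ν (sphereForce stirB polarC) u ∧
    (∃ v : 𝕋³ → E³, Continuous v ∧ IsAxisSymmetric v ∧ IsPTSymmetric v ∧ (((u : L2T) : 𝕋³ → E³) =ᵐ[volume] v)) ∧
    ‖u‖ ^ 2 ≤ E ∧
    |Literature.Analysis.FluidPDE.Torus.pairing (u : L2T) (stirB 2)| ≤ C * ν

/-- The symmetric quiet sequence is a quiet polar family in the sense of `KleinPole` (bookkeeping, PROVED). -/
theorem quietPolar_of_symmetric (h : SymmetricQuietSequence) : QuietPolarSteadyStates := by
  obtain ⟨E, C, hE, hC, h⟩ := h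
  refine ⟨E, hE, fun ν₀ m₀ hν₀ hm₀ => ?_⟩
  have hν₁ : 0 < min ν₀ (m₀ / (C + 1)) := lt_min hν₀ (div_pos hm₀ (by linarith))
  obtain ⟨ν, u, hν, hνlt, hadm, -, hEu, hquiet⟩ := h _ hν₁
  refine ⟨ν, u, hν, lt_of_lt_of_le hνlt (min_le_left _ _), hadm, hEu, ?_⟩
  have hν2 : ν < m₀ / (C + 1) := lt_of_lt_of_le hνlt (min_le_right _ _)
  have hC1 : 0 < C + 1 := by linarith
  calc |Literature.Analysis.FluidPDE.Torus.pairing (u : L2T) (stirB 2)| ≤ C * ν := hquiet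
    _ < C * (m₀ / (C + 1)) := by exact mul_lt_mul_of_pos_left hν2 hC
    _ ≤ m₀ := by
        rw [mul_div_assoc']
        rw [div_le_iff₀ hC1]
        nlinarith

/-- **Composition:** the symmetric-sector line concludes the NEGATION of the crux through the Klein-pole
reduction (`KleinPole.not_noScreening_of_polar`, itself proved from the finite-mixture criterion). -/
theorem not_noScreening_of_symmetricQuiet (hK : PolarKleinOrbit) (h : SymmetricQuietSequence) :
    ¬ Summit.AnomalousDissipation.AnomalousDissipation.Theses.StirringSphere.NoScreening :=
  not_noScreening_of_polar hK (quietPolar_of_symmetric h)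

end Summit.AnomalousDissipation.AnomalousDissipation.Cruxes.NoScreening.SymmetricSector

end
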